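import Literature.Probability.Percolation.MarkedLoopBraidRotation
import Literature.Probability.LatticeModels.TemperleyLiebLinkPatterns
import HarnessLib

/-!
# The tripod-law rotation is the Temperley–Lieb move of Pearce–Rittenberg–de Gier–Nienhuis («TRIPOD-TL-BRIDGE»)

Topic `Literature/Probability/Percolation`; a bridge between two developments of the tree:

* the three-disorder / generic-`k` marked-loop lineage (Khristoforov–Smirnov 2021): `MarkedLoopTripodBasis.lean` (`NCMatching n` — non-crossing
  perfect matchings as symmetric sets of ordered pairs, `closeUp : Pat₀ k → NCMatching (k+1)`), `MarkedLoopCatalan.lean` (`IsNCMatching.partner`) and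
  `MarkedLoopBraidRotation.lean` («TRIPOD-BRAID»: the mark rotation on the tripod-law solution space reads, on outermost patterns,
  `(w ∘ patMap rot)(q) = (−τ)·w(gonNext q) + (−τ²)·w(gonCap q)`, with `closeUp (gonNext q)` the rotated matching of the `(k+1)`-gon and
  `closeUp (gonCap q) = tlCap (closeUp (gonNext q))` its cap-join at the edge `{*, 0}`);
* the Temperley–Lieb layer of the Cardy-formula / percolation-transfer-matrix line (Pearce–Rittenberg–de Gier–Nienhuis 2002):
  `Literature/Probability/LatticeModels/TemperleyLiebLinkPatterns.lean` (`TemperleyLieb.PerfectMatching L` — fixed-point-free involutions —,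
  `IsNonCrossing`, `LinkPattern L`, the diagrammatic monoid move `PerfectMatching.connect p a b` and the generator `tlGen δ a b` on
  `PerfectMatching L →₀ R`, loop weight `δ`; `δ = 1` is percolation).

THIS FILE IDENTIFIES THE TWO: ★★ `ncMatchingEquivLinkPattern : NCMatching n ≃ TemperleyLieb.LinkPattern n` (cyclic non-crossing = linear non-crossing;
`NCMatching.toPM`, `relOfPM`), ★ `relOfPM_connect_star_zero` (the lineage's cap-join `tlCapRel` IS `connect` at the edge `{*, 0}`), ★ `toPM_relMap`
(transport of a matching = `relabel` of the pairing), `tlGen_one_single` (at `δ = 1` the generator `tlGen` is `connect` on basis vectors — no loop factor),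
and the headline ★★★ `solWRot_eq_connect`: FOR EVERY TRIPOD-LAW SOLUTION `w` AND OUTERMOST PATTERN `q`,
`(w ∘ patMap rot)(q) = (−τ)·w(gonNext q) + (−τ²)·w(gonCap q)` WITH `toPM (closeUp (gonNext q)) = (toPM (closeUp q)).relabel (finRotate (k+1))` AND
`toPM (closeUp (gonCap q)) = (toPM (closeUp (gonNext q))).connect * 0` — the relabelling rotation of Khristoforov–Smirnov's `k` marks acts on the
tripod-law solution space as `A⁻¹·ρ + A·(e_{*,0} ∘ ρ)` where `e_{*,0}` is LITERALLY Pearce–Rittenberg–de Gier–Nienhuis's Temperley–Lieb move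
(`connect` / `tlGen 1`) on the link patterns of the `(k+1)`-gon, `A = −τ² = e^{iπ/3}`. As a by-product the marked-loop machinery proves a
planarity fact of the Temperley–Lieb layer: ★★ `isNonCrossing_connect_last_zero` — connecting the last and the first site of a LINK PATTERN gives a link
pattern (every link pattern is `closeUp (gonNext q)` for some outermost `q`, and `connect` of it is `closeUp (gonCap q)`).

Status in print: as for `MarkedLoopBraidRotation.lean` (the identification is the lane's; the Temperley–Lieb move and its loop weight are
Pearce–Rittenberg–de Gier–Nienhuis's (monoid)/(TL), typed in the tree; Khristoforov–Smirnov treat `k = 3`).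

## References
* M. Khristoforov, S. Smirnov, *Percolation and O(1) loop model*, arXiv:2111.15612 (2021), §1.2 (arXiv v1 p. 2: link patterns, cyclic indexing), §2
  Lemma 4 and Fig. 3 (p. 4).
* P. A. Pearce, V. Rittenberg, J. de Gier, B. Nienhuis, *Temperley–Lieb stochastic processes*, J. Phys. A 35 (2002) L661–L668, §2 (eqs. (TL), (monoid):
  the generators on link diagrams, loop weight `q + q⁻¹ = 1` at `q = e^{iπ/3}`).
* L. H. Kauffman, *Knots and Physics* (1991), Part I §7 (`ρ(σ_i) = A + A⁻¹U_i`).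

## Mathlib / tree
Tree: `MarkedLoopBraidRotation.lean` (`gonNext`, `gonCap`, `tlCap`, `tlCapRel`, `closeUp_gonNext`, `closeUp_gonCap`, `gonNext_bijective`, `solWRot_apply_outermost`),
`MarkedLoopTripodBasis.lean` (`NCMatching`, `closeUp`, `openUp`, `closeUp_openUp`), `MarkedLoopCatalan.lean` (`IsNCMatching.partner`, `partner_mem`, `eq_partner`,
`partner_partner`, `partner_ne`), `MarkedLoopRotation.lean` (`relMap`, `mem_relMap`, `IsCyc`, `IsCyc.quad`, `isCyc_rot`), `TemperleyLiebLinkPatterns.lean`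
(`PerfectMatching`, `connect`, `connect_partner`, `connect_of_partner_eq`, `IsNonCrossing`, `LinkPattern`, `tlGen_single`). Mathlib: `Equiv.swap_apply_def`.
-/

open Finset

namespace Literature.Probability.Percolation.MarkedLoops

open Literature.Probability.Percolation.FivePoint (tau)
open Literature.Probability.LatticeModels.TemperleyLieb (PerfectMatching IsNonCrossing LinkPattern tlGen tlGen_single)

/-! ### § Pairings — `NCMatching n ≃ LinkPattern n` -/

section Pairings

variable {m : ℕ}

/-- **the pairing (fixed-point-free involution) of a non-crossing matching** — the marked-loop lineage's `NCMatching` read as Pearce–Rittenberg–de Gier–Nienhuis's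
`PerfectMatching`. [cite: PearceRittenbergDeGierNienhuis2002, §2 (link diagrams); KhristoforovSmirnov2021, §1.2 (arXiv v1 p. 2: «matching marked points»)] -/
noncomputable def NCMatching.toPM (N : NCMatching m) : PerfectMatching m where
  partner := N.2.partner
  partner_partner := N.2.partner_partner
  partner_ne := N.2.partner_ne

/-- the partner function of the pairing. [cite: KhristoforovSmirnov2021, §1.2 (arXiv v1 p. 2)] -/
theorem NCMatching.toPM_partner (N : NCMatching m) (a : Fin m) : N.toPM.partner a = N.2.partner a := rfl

/-- membership in the matching = being partners. [cite: KhristoforovSmirnov2021, §1.2 (arXiv v1 p. 2)] -/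
theorem NCMatching.mem_iff_partner_eq (N : NCMatching m) {a b : Fin m} : (a, b) ∈ N.1 ↔ N.toPM.partner a = b :=
  ⟨fun h => (N.2.eq_partner h).symm, fun h => h ▸ N.2.partner_mem a⟩

/-- **the relation of a pairing** (the set of ordered partner pairs). [cite: PearceRittenbergDeGierNienhuis2002, §2 (link diagrams)] -/
def relOfPM (p : PerfectMatching m) : Finset (Fin m × Fin m) := Finset.univ.filter fun ab => p.partner ab.1 = ab.2

/-- membership in the relation of a pairing. [cite: PearceRittenbergDeGierNienhuis2002, §2] -/
theorem mem_relOfPM {p : PerfectMatching m} {a b : Fin m} : (a, b) ∈ relOfPM p ↔ p.partner a = b := by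
  unfold relOfPM
  rw [Finset.mem_filter]
  exact ⟨fun h => h.2, fun h => ⟨Finset.mem_univ _, h⟩⟩

/-- the relation determines the pairing. [cite: PearceRittenbergDeGierNienhuis2002, §2] -/
theorem relOfPM_injective : Function.Injective (relOfPM (m := m)) := by
  intro p p' h
  apply PerfectMatching.ext
  funext a
  have ha : (a, p.partner a) ∈ relOfPM p' := by rw [← h]; exact mem_relOfPM.2 rfl
  exact (mem_relOfPM.1 ha).symm

/-- the relation of the pairing of a matching is the matching. [cite: KhristoforovSmirnov2021, §1.2 (arXiv v1 p. 2)] -/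
theorem relOfPM_toPM (N : NCMatching m) : relOfPM N.toPM = N.1 := by
  ext ⟨a, b⟩
  rw [mem_relOfPM, NCMatching.mem_iff_partner_eq]

/-- ★ **cyclically non-crossing ⇒ linearly non-crossing**: the pairing of a non-crossing matching is a link pattern in Pearce–Rittenberg–de Gier–Nienhuis's sense.
[cite: PearceRittenbergDeGierNienhuis2002, §2 («non-intersecting half-loops»); KhristoforovSmirnov2021, §1.2 (arXiv v1 p. 2: «disjoint paths»)] -/
theorem isNonCrossing_toPM (N : NCMatching m) : IsNonCrossing N.toPM := by
  intro a b hapa hab hbpa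
  have ha : (a, N.2.partner a) ∈ N.1 := N.2.partner_mem a
  have hb : (b, N.2.partner b) ∈ N.1 := N.2.partner_mem b
  change a < N.2.partner a at hapa
  change b < N.2.partner a at hbpa
  show a < N.2.partner b ∧ N.2.partner b < N.2.partner a
  by_contra hcon
  rw [not_and_or, not_lt, not_lt] at hcon
  rcases hcon with h | h
  · rcases h.lt_or_eq with hlt | heq
    · exact N.2.planar _ _ _ _ ha hb (Or.inr (Or.inr (Or.inr ⟨hlt, hab, hbpa⟩)))
    · have hba : (a, b) ∈ N.1 := N.2.symm _ _ (heq ▸ hb)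
      have : N.2.partner a = b := (N.2.eq_partner hba).symm
      rw [this] at hbpa
      exact lt_irrefl _ hbpa
  · rcases h.lt_or_eq with hlt | heq
    · exact N.2.planar _ _ _ _ ha hb (Or.inl ⟨hab, hbpa, hlt⟩)
    · have : a = b := by
        have e := congrArg N.2.partner heq
        rwa [N.2.partner_partner, N.2.partner_partner] at e
      rw [this] at hab
      exact lt_irrefl _ hab

/-- ★ **linearly non-crossing ⇒ cyclically non-crossing**: the relation of a link pattern is a non-crossing matching in the marked-loop sense.
[cite: PearceRittenbergDeGierNienhuis2002, §2; KhristoforovSmirnov2021, §1.2 (arXiv v1 p. 2)] -/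
theorem isNCMatching_relOfPM (P : LinkPattern m) : IsNCMatching (relOfPM P.1) := by
  have hnc : IsNonCrossing P.1 := P.2
  refine ⟨fun a b h => ?_, fun a h => ?_, fun a => ?_, fun x y z w hxz hyw hq => ?_⟩
  · rw [mem_relOfPM] at h ⊢
    rw [← h, P.1.partner_partner]
  · rw [mem_relOfPM] at h
    exact P.1.partner_ne a h
  · exact ⟨P.1.partner a, mem_relOfPM.2 rfl, fun b hb => (mem_relOfPM.1 hb).symm⟩
  · rw [mem_relOfPM] at hxz hyw
    have hzx : P.1.partner z = x := by rw [← hxz, P.1.partner_partner]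
    have hwy : P.1.partner w = y := by rw [← hyw, P.1.partner_partner]
    rcases hq with ⟨h1, h2, h3⟩ | ⟨h1, h2, h3⟩ | ⟨h1, h2, h3⟩ | ⟨h1, h2, h3⟩
    · -- x < y < z < w, chords {x, z}, {y, w}
      have := hnc x y (hxz ▸ h1.trans h2) h1 (hxz ▸ h2)
      rw [hyw, hxz] at this
      exact lt_asymm h3 this.2
    · -- y < z < w < x
      have := hnc z w (hzx ▸ h2.trans h3) h2 (hzx ▸ h3)
      rw [hwy] at this
      exact lt_asymm h1 this.1
    · -- z < w < x < y
      have := hnc z w (hzx ▸ h1.trans h2) h1 (hzx ▸ h2)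
      rw [hwy, hzx] at this
      exact lt_asymm h3 this.2
    · -- w < x < y < z
      have := hnc x y (hxz ▸ h2.trans h3) h2 (hxz ▸ h3)
      rw [hyw] at this
      exact lt_asymm h1 this.1

/-- ★★ **THE TWO LINEAGES' LINK PATTERNS ARE THE SAME OBJECT**: non-crossing matchings of `n` cyclically ordered points (marked-loop lineage) ≃ link patterns on
`n` sites (Pearce–Rittenberg–de Gier–Nienhuis). [cite: PearceRittenbergDeGierNienhuis2002, §2 («non-intersecting half-loops», `C_{L,m}`); KhristoforovSmirnov2021, §1.2 (arXiv v1 p. 2)] -/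
noncomputable def ncMatchingEquivLinkPattern (m : ℕ) : NCMatching m ≃ LinkPattern m where
  toFun N := ⟨N.toPM, isNonCrossing_toPM N⟩
  invFun P := ⟨relOfPM P.1, isNCMatching_relOfPM P⟩
  left_inv N := Subtype.ext (relOfPM_toPM N)
  right_inv P := by
    apply Subtype.ext
    apply PerfectMatching.ext
    funext a
    show (isNCMatching_relOfPM P).partner a = P.1.partner a
    exact ((isNCMatching_relOfPM P).eq_partner (mem_relOfPM.2 rfl)).symm

/-- the equivalence is `toPM` on the nose. [cite: KhristoforovSmirnov2021, §1.2 (arXiv v1 p. 2)] -/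
theorem ncMatchingEquivLinkPattern_apply (N : NCMatching m) : (ncMatchingEquivLinkPattern m N).1 = N.toPM := rfl

/-- the two counts agree (Catalan many for an even number of points, via the lineage's `card_ncMatching_eq`).
[cite: PearceRittenbergDeGierNienhuis2002, §2 (`C_{L,m}`); KhristoforovSmirnov2021, §1.2 (arXiv v1 p. 2)] -/
theorem card_linkPattern_eq_card_ncMatching (m : ℕ) : Fintype.card (LinkPattern m) = Fintype.card (NCMatching m) :=
  (Fintype.card_congr (ncMatchingEquivLinkPattern m)).symm

end Pairings

/-! ### § Moves — transport = `relabel`, cap-join = `connect`, `tlGen 1` = `connect` -/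

section Moves

variable {m : ℕ}

/-- **relabelling a pairing** along a permutation of the sites: `partner (σ i) = σ (partner i)`. [cite: PearceRittenbergDeGierNienhuis2002, §2; KhristoforovSmirnov2021, §1.2 (arXiv v1 p. 2: cyclic indexing)] -/
def pmRelabel (σ : Equiv.Perm (Fin m)) (p : PerfectMatching m) : PerfectMatching m where
  partner i := σ (p.partner (σ.symm i))
  partner_partner i := by rw [Equiv.symm_apply_apply, p.partner_partner, Equiv.apply_symm_apply]
  partner_ne i h := p.partner_ne (σ.symm i) (σ.injective (by rw [Equiv.apply_symm_apply]; exact h))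

/-- the relabelled partner function. [cite: KhristoforovSmirnov2021, §1.2 (arXiv v1 p. 2: cyclic indexing)] -/
theorem pmRelabel_partner (σ : Equiv.Perm (Fin m)) (p : PerfectMatching m) (i : Fin m) :
    (pmRelabel σ p).partner i = σ (p.partner (σ.symm i)) := rfl

/-- ★ **a cyclic symmetry transports non-crossing matchings** (symmetric, irreflexive, perfect by the bijection; planar by `IsCyc.quad`).
[cite: KhristoforovSmirnov2021, §1.2 (arXiv v1 p. 2: cyclic indexing)] -/
theorem IsNCMatching.mapCyc {N : Finset (Fin m × Fin m)} (hN : IsNCMatching N) {σ : Equiv.Perm (Fin m)} (hσ : IsCyc σ) :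
    IsNCMatching (relMap σ N) := by
  refine ⟨fun a b h => ?_, fun a h => ?_, fun a => ?_, fun x y z w hxz hyw hq => ?_⟩
  · rw [mem_relMap] at h ⊢; exact hN.symm _ _ h
  · rw [mem_relMap] at h; exact hN.irrefl _ h
  · refine ⟨σ (hN.partner (σ.symm a)), ?_, fun b hb => ?_⟩
    · show (a, σ (hN.partner (σ.symm a))) ∈ relMap σ N
      rw [mem_relMap, Equiv.symm_apply_apply]; exact hN.partner_mem _
    · have hb' : (a, b) ∈ relMap σ N := hb
      rw [mem_relMap] at hb'
      rw [← hN.eq_partner hb', Equiv.apply_symm_apply]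
  · rw [mem_relMap] at hxz hyw
    exact hN.planar _ _ _ _ hxz hyw ((hσ.symm.quad x y z w).2 hq)

/-- **transporting a non-crossing matching along a cyclic symmetry**, as a matching. [cite: KhristoforovSmirnov2021, §1.2 (arXiv v1 p. 2)] -/
def NCMatching.relMapNC (σ : Equiv.Perm (Fin m)) (hσ : IsCyc σ) (N : NCMatching m) : NCMatching m :=
  ⟨relMap σ N.1, N.2.mapCyc hσ⟩

/-- ★ **transport of a matching = relabelling of its pairing.** [cite: KhristoforovSmirnov2021, §1.2 (arXiv v1 p. 2: cyclic indexing); PearceRittenbergDeGierNienhuis2002, §2] -/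
theorem toPM_relMapNC (σ : Equiv.Perm (Fin m)) (hσ : IsCyc σ) (N : NCMatching m) :
    (N.relMapNC σ hσ).toPM = pmRelabel σ N.toPM := by
  apply PerfectMatching.ext
  funext i
  rw [pmRelabel_partner, NCMatching.toPM_partner, NCMatching.toPM_partner]
  symm
  apply (N.2.mapCyc hσ).eq_partner
  show (i, σ (N.2.partner (σ.symm i))) ∈ relMap σ N.1
  rw [mem_relMap, Equiv.symm_apply_apply]
  exact N.2.partner_mem _

/-- the relation of a relabelled pairing is the transported relation. [cite: KhristoforovSmirnov2021, §1.2 (arXiv v1 p. 2)] -/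
theorem relOfPM_pmRelabel (σ : Equiv.Perm (Fin m)) (p : PerfectMatching m) : relOfPM (pmRelabel σ p) = relMap σ (relOfPM p) := by
  ext ⟨a, b⟩
  rw [mem_relOfPM, mem_relMap, mem_relOfPM, pmRelabel_partner, ← Equiv.eq_symm_apply]

variable {n : ℕ}

/-- ★ **THE LINEAGE'S CAP-JOIN IS PEARCE–RITTENBERG–DE GIER–NIENHUIS'S `connect`**: for EVERY pairing `p` of the `(k+1)`-gon, the relation of `p.connect * 0`
(`*` = the last site) is `tlCapRel (relOfPM p) (p *) (p 0)` — keep the chords avoiding `*` and `0`, cap `{*, 0}`, join the former partners.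
[cite: PearceRittenbergDeGierNienhuis2002, §2 (monoid); KhristoforovSmirnov2021, §1.2 (arXiv v1 p. 2)] -/
theorem relOfPM_connect_star_zero (p : PerfectMatching (n + 1 + 1)) :
    relOfPM (p.connect (Fin.last (n + 1)) 0) = tlCapRel (relOfPM p) (p.partner (Fin.last (n + 1))) (p.partner 0) := by
  have hl0 : Fin.last (n + 1) ≠ 0 := fun e => by
    have := congrArg Fin.val e
    rw [Fin.val_last, Fin.val_zero] at this
    omega
  ext ⟨x, y⟩
  unfold tlCapRel
  rw [mem_relOfPM, mem_withPair, mem_withPair, Finset.mem_filter, mem_relOfPM, PerfectMatching.connect_partner]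
  simp only
  by_cases h0 : p.partner (Fin.last (n + 1)) = 0
  · -- the cap `{*, 0}` is already there: `connect` changes nothing
    have h0' : p.partner 0 = Fin.last (n + 1) := by rw [← h0, p.partner_partner]
    rw [h0', h0, Equiv.swap_self, Equiv.refl_apply, Equiv.refl_apply]
    constructor
    · intro h
      by_cases hx : x = Fin.last (n + 1)
      · subst hx; rw [h0] at h; exact Or.inr (Or.inr (Or.inl ⟨rfl, h.symm⟩))
      by_cases hx0 : x = 0
      · subst hx0; rw [h0'] at h; exact Or.inl ⟨rfl, h.symm⟩
      refine Or.inr (Or.inr (Or.inr (Or.inr ⟨h, hx, hx0, fun hy => hx0 ?_, fun hy => hx ?_⟩)))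
      · subst hy; rw [← p.partner_partner x, h, h0]
      · subst hy; rw [← p.partner_partner x, h, h0']
    · rintro (⟨rfl, rfl⟩ | ⟨rfl, rfl⟩ | ⟨rfl, rfl⟩ | ⟨rfl, rfl⟩ | ⟨h, -⟩)
      · exact h0'
      · exact h0
      · exact h0
      · exact h0'
      · exact h
  · -- `*` and `0` are not partners: their partners `a = p *`, `b = p 0` get joined
    have hal : p.partner (Fin.last (n + 1)) ≠ Fin.last (n + 1) := p.partner_ne _
    have hb0 : p.partner 0 ≠ 0 := p.partner_ne _
    have hbl : p.partner 0 ≠ Fin.last (n + 1) := fun e => h0 (by rw [← e, p.partner_partner])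
    have hab : p.partner (Fin.last (n + 1)) ≠ p.partner 0 := fun e => hl0 (p.partner_inj.1 e)
    have hpa : p.partner (p.partner (Fin.last (n + 1))) = Fin.last (n + 1) := p.partner_partner _
    have hpb : p.partner (p.partner 0) = 0 := p.partner_partner _
    constructor
    · intro h
      by_cases hx : x = Fin.last (n + 1)
      · subst hx
        rw [Equiv.swap_apply_left, hpb, Equiv.swap_apply_of_ne_of_ne hl0.symm hb0.symm] at h
        exact Or.inr (Or.inr (Or.inl ⟨rfl, h.symm⟩))
      by_cases hxb : x = p.partner 0
      · subst hxb
        rw [Equiv.swap_apply_right, Equiv.swap_apply_of_ne_of_ne hal hab] at h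
        exact Or.inr (Or.inl ⟨rfl, h.symm⟩)
      · rw [Equiv.swap_apply_of_ne_of_ne hx hxb] at h
        by_cases hx0 : x = 0
        · subst hx0
          rw [Equiv.swap_apply_right] at h
          exact Or.inr (Or.inr (Or.inr (Or.inl ⟨rfl, h.symm⟩)))
        by_cases hxa : x = p.partner (Fin.last (n + 1))
        · subst hxa
          rw [hpa, Equiv.swap_apply_left] at h
          exact Or.inl ⟨rfl, h.symm⟩
        · have h1 : p.partner x ≠ Fin.last (n + 1) := fun e => hxa (by rw [← e, p.partner_partner])
          have h2 : p.partner x ≠ p.partner 0 := fun e => hx0 (p.partner_inj.1 e)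
          rw [Equiv.swap_apply_of_ne_of_ne h1 h2] at h
          refine Or.inr (Or.inr (Or.inr (Or.inr ⟨h, hx, hx0, ?_, ?_⟩)))
          · rw [← h]; exact h1
          · rw [← h]; intro e; exact hxb (p.partner_inj.1 (by rw [e, hpb]))
    · rintro (⟨rfl, rfl⟩ | ⟨rfl, rfl⟩ | ⟨rfl, rfl⟩ | ⟨rfl, rfl⟩ | ⟨h, hx, hx0, hy, hy0⟩)
      · -- x = a, y = b
        rw [Equiv.swap_apply_of_ne_of_ne hal hab, hpa, Equiv.swap_apply_left]
      · -- x = b, y = a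
        rw [Equiv.swap_apply_right, Equiv.swap_apply_of_ne_of_ne hal hab]
      · -- x = *, y = 0
        rw [Equiv.swap_apply_left, hpb, Equiv.swap_apply_of_ne_of_ne hl0.symm hb0.symm]
      · -- x = 0, y = *
        rw [Equiv.swap_apply_of_ne_of_ne hl0.symm hb0.symm, Equiv.swap_apply_right]
      · -- a chord avoiding `*` and `0`
        have hxa : x ≠ p.partner (Fin.last (n + 1)) := fun e => hy (by rw [← h, e, hpa])
        have hxb : x ≠ p.partner 0 := fun e => hy0 (by rw [← h, e, hpb])
        have h1 : p.partner x ≠ Fin.last (n + 1) := by rw [h]; exact hy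
        have h2 : p.partner x ≠ p.partner 0 := fun e => hx0 (p.partner_inj.1 e)
        rw [Equiv.swap_apply_of_ne_of_ne hx hxb, Equiv.swap_apply_of_ne_of_ne h1 h2, h]

end Moves

/-! ### § Bridge — the mark rotation is `connect` after the polygon rotation; planarity of `connect` -/

section Bridge

variable {n : ℕ}

/-- ★ **at loop weight one the Temperley–Lieb generator is the `connect` move on basis vectors** (no loop factor: a matching already containing the cap is
fixed). [cite: PearceRittenbergDeGierNienhuis2002, §2 (TL), (monoid) (`q + q⁻¹ = 1` at `q = e^{iπ/3}`)] -/
theorem tlGen_one_single {L : ℕ} (a b : Fin L) (p : PerfectMatching L) :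
    tlGen ℂ (1 : ℂ) a b (Finsupp.single p 1) = Finsupp.single (p.connect a b) 1 := by
  rw [tlGen_single, one_smul]
  split_ifs with h
  · rw [one_smul, PerfectMatching.connect_of_partner_eq p h]
  · rfl

/-- ★ **the polygon successor is the relabelling of the pairing along the rotation of the `(k+1)`-gon.**
[cite: KhristoforovSmirnov2021, §1.2 (arXiv v1 p. 2: cyclic indexing); PearceRittenbergDeGierNienhuis2002, §2] -/
theorem toPM_closeUp_gonNext (q : Pat₀ (n + 1)) :
    (closeUp (gonNext q)).toPM = pmRelabel (rot (n + 1 + 1)) (closeUp q).toPM := by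
  apply relOfPM_injective
  rw [relOfPM_toPM, relOfPM_pmRelabel, relOfPM_toPM, closeUp_gonNext]

/-- ★★ **THE CAPPED SUCCESSOR IS PEARCE–RITTENBERG–DE GIER–NIENHUIS'S `connect` AT THE EDGE `{*, 0}`** of the rotated pairing.
[cite: PearceRittenbergDeGierNienhuis2002, §2 (monoid); KhristoforovSmirnov2021, §2 Lemma 4 and Fig. 3 (arXiv v1 p. 4)] -/
theorem toPM_closeUp_gonCap (q : Pat₀ (n + 1)) :
    (closeUp (gonCap q)).toPM = ((closeUp (gonNext q)).toPM).connect (Fin.last (n + 1)) 0 := by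
  apply relOfPM_injective
  rw [relOfPM_toPM, relOfPM_connect_star_zero, relOfPM_toPM, closeUp_gonCap]
  rfl

/-- ★★★ **THE RELABELLING ROTATION OF KHRISTOFOROV–SMIRNOV'S MARKS IS THE TEMPERLEY–LIEB MOVE OF PEARCE–RITTENBERG–DE GIER–NIENHUIS AFTER THE POLYGON ROTATION.**
For every tripod-law solution `w ∈ solW k` and every outermost pattern `q` (a link pattern of the `(k+1)`-gon): `(w ∘ patMap rot)(q) = (−τ)·w(gonNext q) +
(−τ²)·w(gonCap q)`, where the pairing of `gonNext q` is the `finRotate (k+1)`-relabelling of that of `q` and the pairing of `gonCap q` is `connect * 0` of it —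
i.e. `rot = A⁻¹·ρ + A·(e_{*,0} ∘ ρ)` with `e_{*,0} = tlGen 1 * 0` (`tlGen_one_single`), `A = −τ²`, `A⁻¹ = −τ`.
[cite: KhristoforovSmirnov2021, §2 Lemma 4, proof and Fig. 3 (arXiv v1 p. 4); PearceRittenbergDeGierNienhuis2002, §2 (TL), (monoid); Kauffman1991KnotsPhysics, Part I §7 Prop. 7.5] -/
theorem solWRot_eq_connect (w : solW (n + 1)) (q : Pat₀ (n + 1)) :
    (solWRot (n + 1) (rot (n + 1)) isCyc_rot w : Pat (n + 1) → ℂ) q.1 = (-tau) * w.1 (gonNext q).1 + (-tau ^ 2) * w.1 (gonCap q).1 ∧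
      (closeUp (gonNext q)).toPM = pmRelabel (rot (n + 1 + 1)) (closeUp q).toPM ∧
      (closeUp (gonCap q)).toPM = ((closeUp (gonNext q)).toPM).connect (Fin.last (n + 1)) 0 :=
  ⟨solWRot_apply_outermost w q, toPM_closeUp_gonNext q, toPM_closeUp_gonCap q⟩

/-- every link pattern of the `(k+1)`-gon is the pairing of `closeUp (gonNext q)` for some outermost pattern `q` (the polygon successor is a bijection).
[cite: KhristoforovSmirnov2021, §1.2 (arXiv v1 p. 2); PearceRittenbergDeGierNienhuis2002, §2] -/
theorem exists_eq_toPM_closeUp_gonNext (P : LinkPattern (n + 1 + 1)) : ∃ q : Pat₀ (n + 1), P.1 = (closeUp (gonNext q)).toPM := by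
  obtain ⟨q, hq⟩ := gonNext_bijective.2 (openUp ((ncMatchingEquivLinkPattern (n + 1 + 1)).symm P))
  refine ⟨q, ?_⟩
  rw [hq, closeUp_openUp]
  show P.1 = ((ncMatchingEquivLinkPattern (n + 1 + 1)) ((ncMatchingEquivLinkPattern (n + 1 + 1)).symm P)).1
  rw [Equiv.apply_symm_apply]

/-- ★★ **PLANARITY OF THE TEMPERLEY–LIEB MOVE AT THE EDGE `{*, 0}`, proved by the marked-loop machinery**: connecting the last and the first site of a link pattern
gives a link pattern (it is the pairing of `closeUp (gonCap q)`). [cite: PearceRittenbergDeGierNienhuis2002, §2 (the link patterns span a sub-representation); KhristoforovSmirnov2021, §1.2 (arXiv v1 p. 2)] -/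
theorem isNonCrossing_connect_last_zero (P : LinkPattern (n + 1 + 1)) : IsNonCrossing (P.1.connect (Fin.last (n + 1)) 0) := by
  obtain ⟨q, hq⟩ := exists_eq_toPM_closeUp_gonNext P
  rw [hq, ← toPM_closeUp_gonCap]
  exact isNonCrossing_toPM _

/-- the Temperley–Lieb move at the edge `{*, 0}` as a map of link patterns. [cite: PearceRittenbergDeGierNienhuis2002, §2 (monoid)] -/
def linkPatternCapLastZero (P : LinkPattern (n + 1 + 1)) : LinkPattern (n + 1 + 1) :=
  ⟨P.1.connect (Fin.last (n + 1)) 0, isNonCrossing_connect_last_zero P⟩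

/-- the move is idempotent on link patterns (`e² = e` at loop weight one). [cite: PearceRittenbergDeGierNienhuis2002, §2 (TL)] -/
theorem linkPatternCapLastZero_idem (P : LinkPattern (n + 1 + 1)) : linkPatternCapLastZero (linkPatternCapLastZero P) = linkPatternCapLastZero P :=
  Subtype.ext (PerfectMatching.connect_connect _ _ _)

end Bridge

/-! ### § Planarity — every nearest-neighbour Temperley–Lieb move preserves link patterns -/

section Planarity

variable {m n : ℕ}

/-- relabelling along a product is relabelling twice. [cite: KhristoforovSmirnov2021, §1.2 (arXiv v1 p. 2: cyclic indexing)] -/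
theorem pmRelabel_mul (σ ρ : Equiv.Perm (Fin m)) (p : PerfectMatching m) : pmRelabel (σ * ρ) p = pmRelabel σ (pmRelabel ρ p) := by
  apply PerfectMatching.ext
  funext i
  simp only [pmRelabel_partner, Equiv.Perm.mul_apply]
  rfl

/-- relabelling along the identity does nothing. [cite: KhristoforovSmirnov2021, §1.2 (arXiv v1 p. 2)] -/
theorem pmRelabel_one (p : PerfectMatching m) : pmRelabel 1 p = p := by
  apply PerfectMatching.ext
  funext i
  rfl

/-- ★ **relabelling commutes with the Temperley–Lieb move**: `(σ·p).connect (σ a) (σ b) = σ·(p.connect a b)`.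
[cite: PearceRittenbergDeGierNienhuis2002, §2 (monoid); KhristoforovSmirnov2021, §1.2 (arXiv v1 p. 2: cyclic indexing)] -/
theorem connect_pmRelabel (σ : Equiv.Perm (Fin m)) (p : PerfectMatching m) (a b : Fin m) :
    (pmRelabel σ p).connect (σ a) (σ b) = pmRelabel σ (p.connect a b) := by
  apply PerfectMatching.ext
  funext i
  simp only [PerfectMatching.connect_partner, pmRelabel_partner, Equiv.symm_apply_apply, Equiv.swap_apply_apply, Equiv.Perm.mul_apply,
    Equiv.Perm.inv_def]

/-- ★ **cyclic relabellings preserve link patterns** (through the equivalence with the marked-loop lineage's non-crossing matchings and `IsNCMatching.mapCyc`).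
[cite: PearceRittenbergDeGierNienhuis2002, §2; KhristoforovSmirnov2021, §1.2 (arXiv v1 p. 2: cyclic indexing)] -/
theorem isNonCrossing_pmRelabel_rot_pow (P : LinkPattern m) (s : ℕ) : IsNonCrossing (pmRelabel (rot m ^ s) P.1) := by
  have hP : P.1 = ((ncMatchingEquivLinkPattern m).symm P).toPM := by
    rw [← ncMatchingEquivLinkPattern_apply, Equiv.apply_symm_apply]
  rw [hP, ← toPM_relMapNC (rot m ^ s) (isCyc_rot_pow s)]
  exact isNonCrossing_toPM _

/-- the power of the polygon rotation carrying the edge `{*, 0}` to the edge `{j, j+1}`. [cite: KhristoforovSmirnov2021, §1.2 (arXiv v1 p. 2: cyclic indexing)] -/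
theorem rot_pow_last_eq_castSucc (j : Fin (n + 1)) : (rot (n + 1 + 1) ^ (j.val + 1)) (Fin.last (n + 1)) = Fin.castSucc j := by
  apply Fin.ext
  rw [val_rot_pow, Fin.val_last, Fin.val_castSucc, show n + 1 + (j.val + 1) = j.val + (n + 1 + 1) by ring, Nat.add_mod_right,
    Nat.mod_eq_of_lt (by have := j.2; omega)]

/-- Auxiliary. [cite: KhristoforovSmirnov2021, §1.2 (arXiv v1 p. 2: cyclic indexing)] -/
theorem rot_pow_zero_eq_succ (j : Fin (n + 1)) : (rot (n + 1 + 1) ^ (j.val + 1)) 0 = j.succ := by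
  apply Fin.ext
  rw [val_rot_pow, Fin.val_zero, Fin.val_succ, zero_add, Nat.mod_eq_of_lt (by have := j.2; omega)]

/-- ★★★ **EVERY NEAREST-NEIGHBOUR TEMPERLEY–LIEB MOVE PRESERVES LINK PATTERNS**: for a link pattern `P` on `L = n+2` sites and `j < L − 1`, `P.connect j (j+1)` is a link
pattern — the planarity half of «the span of `LinkPattern` is invariant under `tlE`» (listed as open in `TemperleyLiebLinkPatterns.lean`), obtained here from the
marked-loop machinery: conjugate `isNonCrossing_connect_last_zero` by the polygon rotation.
[cite: PearceRittenbergDeGierNienhuis2002, §2 (the `0`-defect link patterns span a sub-representation); KhristoforovSmirnov2021, §1.2 (arXiv v1 p. 2)] -/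
theorem isNonCrossing_connect_succ (P : LinkPattern (n + 1 + 1)) (j : Fin (n + 1)) :
    IsNonCrossing (P.1.connect (Fin.castSucc j) j.succ) := by
  set σ : Equiv.Perm (Fin (n + 1 + 1)) := rot (n + 1 + 1) ^ (j.val + 1) with hσ
  set t : ℕ := n + 1 + 1 - (j.val + 1) with ht
  have hmul : σ * rot (n + 1 + 1) ^ t = 1 := by
    rw [hσ, ← pow_add, show j.val + 1 + t = n + 1 + 1 by have := j.2; omega, rot_pow_polygon]
  -- `Q := rot^t · P` is a link pattern with `σ · Q = P`
  have hQnc : IsNonCrossing (pmRelabel (rot (n + 1 + 1) ^ t) P.1) := isNonCrossing_pmRelabel_rot_pow P t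
  have hPQ : P.1 = pmRelabel σ (pmRelabel (rot (n + 1 + 1) ^ t) P.1) := by
    rw [← pmRelabel_mul, hmul, pmRelabel_one]
  rw [← rot_pow_last_eq_castSucc j, ← rot_pow_zero_eq_succ j, hPQ, connect_pmRelabel]
  -- the capped pattern is a link pattern, and so is its relabelling
  exact isNonCrossing_pmRelabel_rot_pow ⟨_, isNonCrossing_connect_last_zero ⟨_, hQnc⟩⟩ (j.val + 1)

/-- ★★ **PEARCE–RITTENBERG–DE GIER–NIENHUIS'S GENERATOR `tlE 1 j` MAPS LINK PATTERNS TO LINK PATTERNS** (basis vectors, loop weight one).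
[cite: PearceRittenbergDeGierNienhuis2002, §2 (TL), (monoid)] -/
theorem tlE_one_single_linkPattern (P : LinkPattern (n + 1 + 1)) (j : Fin (n + 1)) :
    Literature.Probability.LatticeModels.TemperleyLieb.tlE (1 : ℂ) j (Finsupp.single P.1 1) =
      Finsupp.single (⟨P.1.connect (Fin.castSucc j) j.succ, isNonCrossing_connect_succ P j⟩ : LinkPattern (n + 1 + 1)).1 1 :=
  tlGen_one_single _ _ _

end Planarity

end Literature.Probability.Percolation.MarkedLoops
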